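import Summits.QuantumFields.YangMills.Theorems.SoloBlindDilutionMonotone
import Mathlib.Algebra.BigOperators.Ring.Finset
import Mathlib.Algebra.Algebra.Basic
import Mathlib.Data.Real.Basic
import Mathlib.Tactic
import HarnessLib

/-!
# The annealed-dilution expansion of an interpolated product weight, and (5.15) from (P2)+(P3)

Solo-blind deliverable D16 (obstruction infrastructure; no summit claim).  Companion of
`SoloBlindDilutionMonotone` (D15).

Setting.  `A` is a commutative real algebra (think: bounded functions of the lattice gauge field),
`ℓ : A →ₗ[ℝ] ℝ` a linear functional (think: integration against product Haar measure), `P` a finite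
index set (plaquettes), `F G : P → A` two families of plaquette factors (think: `F p = f(U_∂p)` the
untwisted and `G p` the centre-twisted Boltzmann factor, `G p = F p` off the vortex sheet).  For
`w ∈ [0,1]` the interpolated factor is `w • F p + (1 - w) • 1` ("plaquette `p` active with probability
`w`").

* `prod_dilute_eq` (P1, algebraic):  `∏_p (w F_p + (1-w)) = ∑_S bernoulliWeight w S • ∏_{p∈S} F_p`.
* `functional_dilute_eq`:  applying `ℓ`, the interpolated partition function is the Bernoulli mixture
  `∑_S bernoulliWeight w S * Z_S` of the restricted ones `Z_S = ℓ (∏_{p∈S} F_p)`.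
* `interpolation_ratio_antitone`:  if `S ↦ Z_S = ℓ(∏_{p ∈ S} F_p) > 0` satisfies the FKG lattice
  condition (P2) and `S ↦ ℓ(∏_{p∈S} G_p) / ℓ(∏_{p∈S} F_p)` is antitone and nonnegative (P3), then the
  twisted/untwisted ratio of the interpolated model,
  `ℓ(∏_p (w G_p + (1-w))) / ℓ(∏_p (w F_p + (1-w)))`, is non-increasing in `w ∈ (0,1)` — which, for
  Tomboulis's interpolation with lower-bound coefficients `c^L = 0` (arXiv:0707.2179), is his
  inequality (5.15) at that step.  (P2) and (P3) are hypotheses here (for abelian groups and GKS-class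
  weights they are Griffiths II and Ginibre's comparison inequality; paper/breaks.md A6(vii)).
-/

namespace Summit.QuantumFields.YangMills.Theorems.SoloBlind

open Finset

variable {P : Type*} [Fintype P] [DecidableEq P] {A : Type*} [CommRing A] [Algebra ℝ A]

/-- **(P1) Dilution expansion.**  `∏_p (w F_p + (1 - w)) = ∑_S B_w(S) ∏_{p ∈ S} F_p` with
`B_w(S) = w^#S (1-w)^#Sᶜ`. -/
theorem prod_dilute_eq (w : ℝ) (F : P → A) :
    ∏ p, (algebraMap ℝ A w * F p + algebraMap ℝ A (1 - w))
      = ∑ S : Finset P, algebraMap ℝ A (bernoulliWeight w S) * ∏ p ∈ S, F p := by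
  rw [Fintype.prod_add]
  refine Finset.sum_congr rfl (fun S _ => ?_)
  rw [prod_const, ← pow_card_mul_prod, bernoulliWeight, map_mul, map_pow, map_pow]
  ring

/-- The interpolated "partition function" is the Bernoulli mixture of the restricted ones. -/
theorem functional_dilute_eq (ℓ : A →ₗ[ℝ] ℝ) (w : ℝ) (F : P → A) :
    ℓ (∏ p, (algebraMap ℝ A w * F p + algebraMap ℝ A (1 - w)))
      = ∑ S : Finset P, bernoulliWeight w S * ℓ (∏ p ∈ S, F p) := by
  rw [prod_dilute_eq, map_sum]
  refine Finset.sum_congr rfl (fun S _ => ?_)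
  rw [← Algebra.smul_def, map_smul, smul_eq_mul]

/-- **(5.15) on the `c^L = 0` ray from (P2)+(P3).**  FKG lattice condition for
`S ↦ ℓ(∏_{p∈S} F_p) > 0` and antitonicity (with nonnegativity) of `S ↦ ℓ(∏_{p∈S} G_p)/ℓ(∏_{p∈S} F_p)`
imply that the ratio of the `G`- and `F`-interpolated functionals is non-increasing in `w ∈ (0,1)`. -/
theorem interpolation_ratio_antitone (ℓ : A →ₗ[ℝ] ℝ) (F G : P → A)
    (hZpos : ∀ S : Finset P, 0 < ℓ (∏ p ∈ S, F p))
    (hGnn : ∀ S : Finset P, 0 ≤ ℓ (∏ p ∈ S, G p))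
    (hlat : ∀ S T : Finset P,
      ℓ (∏ p ∈ S, F p) * ℓ (∏ p ∈ T, F p) ≤ ℓ (∏ p ∈ S ∩ T, F p) * ℓ (∏ p ∈ S ∪ T, F p))
    (hanti : ∀ S T : Finset P, S ⊆ T →
      ℓ (∏ p ∈ T, G p) / ℓ (∏ p ∈ T, F p) ≤ ℓ (∏ p ∈ S, G p) / ℓ (∏ p ∈ S, F p))
    {w w' : ℝ} (hw0 : 0 < w) (hww' : w ≤ w') (hw'1 : w' < 1) :
    ℓ (∏ p, (algebraMap ℝ A w' * G p + algebraMap ℝ A (1 - w')))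
        / ℓ (∏ p, (algebraMap ℝ A w' * F p + algebraMap ℝ A (1 - w')))
      ≤ ℓ (∏ p, (algebraMap ℝ A w * G p + algebraMap ℝ A (1 - w)))
        / ℓ (∏ p, (algebraMap ℝ A w * F p + algebraMap ℝ A (1 - w))) := by
  set Z : Finset P → ℝ := fun S => ℓ (∏ p ∈ S, F p) with hZ
  set r : Finset P → ℝ := fun S => ℓ (∏ p ∈ S, G p) / ℓ (∏ p ∈ S, F p) with hr
  have key : ∀ S : Finset P, ℓ (∏ p ∈ S, G p) = Z S * r S := by
    intro S
    simp only [hZ, hr]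
    rw [mul_div_cancel₀ _ (hZpos S).ne']
  simp only [functional_dilute_eq, key]
  exact dilution_twistedRatio_antitone Z r hZpos (fun S => div_nonneg (hGnn S) (hZpos S).le)
    hlat hanti hw0 hww' hw'1

end Summit.QuantumFields.YangMills.Theorems.SoloBlind
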